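import Summits.HodgeConjecture.HodgeConjecture.Theorems.SixfoldTableXCensusEllipticRows
import Summits.HodgeConjecture.HodgeConjecture.Theorems.Ring2AtlasTypeIIRows
import Literature.AlgebraicGeometry.HodgeTheory.RealMultiplicationRelDimThreePowersHodgeClasses
import Literature.AlgebraicGeometry.HodgeTheory.RealMultiplicationRelDimTwoPowersHodgeClasses
import Literature.AlgebraicGeometry.HodgeTheory.RealMultiplicationPowersHodgeClasses
import Literature.AlgebraicGeometry.HodgeTheory.TotallyRealMaxSubfieldPowersHodgeClasses
import Literature.AlgebraicGeometry.Motives.AbelianVarietySimpleOfEndAlgebraDomain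
import HarnessLib

/-!
# TABLE X (dimension 6) — the census nodes X2 / X1 DISCHARGED IN THE KERNEL on the simple type-I / type-II rows
# whose `B = D` is a PROVED tree theorem (Ribet 1983 / Tankeev in relative dimension 3, 2, 1; V. K. Murty 1988,
# `m = 1`), unconditionally (cell `pub-hodgeav-hg6`, req-37 (A) Q2b; eng-5 g3)

HONEST FRAMING. HC, `HC_AV` (stmt-1333), `HC_CM` (stmt-3052) and the rung H2 are NOT proved and do not occur here. The
census nodes `TableX.SixfoldCodimTwoCensus` (X2) / `TableX.SixfoldCodimThreeCensus` (X1) of `SixfoldTableXCover` are OURS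
(`@[conjecture]`), never asserted. KERNEL ONLY: theorems over existing declarations; no definition, no `sorry`, no named
fact (every input is a THEOREM of the tree); typed ≠ proved.

WHY THIS MODULE (census-node self-audit, axis A7 «a row VERIFIED in the kernel, not by dossier», continued). L8
(`SixfoldTableXCensusEllipticRows`) verified the per-variety CONCLUSIONS of X2 / X1 on TABLE X row 28 (elliptic isogeny
classes) and gave the entry points `codimTwoCensusAt_of_divisorial` / `codimThreeCensusAt_of_divisorial` («`B = D` ⟹ the
census conclusion, divisor summand alone»); L9 (eng-4 g3) takes the Künneth / product rows. THIS FILE does the SIMPLE rows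
of TABLE X (`HOME/TABLE-X-g6-v0.md` §1 rows 1–15) on which `Bᵖ(A) = Dᵖ(A) ⊗ ℂ` for all `p` (`IsDivisorGenerated A`) is an
UNCONDITIONAL theorem of the tree:
* row 2 `g6.I(2)` — `End⁰(A)` a real quadratic field (relative dimension 3): Ribet 1983 Thm. 1, PROVED in the tree
  (`AbelianVariety.isDivisorGenerated_of_isTotallyReal_of_three_mul_finrank_eq`, file
  `RealMultiplicationRelDimThreePowersHodgeClasses`);
* row 3 `g6.I(3)` — `End⁰(A)` a totally real cubic field (relative dimension 2): Moonen–Zarhin Type I(2) / BGK,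
  PROVED (`AbelianVariety.isDivisorGenerated_of_isTotallyReal_of_two_mul_finrank_eq`);
* row 4 `g6.I(6)` — `End⁰(A)` a totally real sextic field (relative dimension 1): Ribet 1983 Thm. 0, PROVED
  (`AbelianVariety.isDivisorGenerated_of_isTotallyReal`);
* row 6 `g6.II(3)` (and again row 4) — `End⁰(A)` contains a SELF-COMMUTANT totally real sextic field `K`, i.e. a Murty
  packet `(K, φ, 1)`: V. K. Murty 1988 Thm. 2, case `m = 1`, PROVED (`AbelianVariety.isDivisorGenerated_of_isMurtyTypeWith_one`,
  file `TotallyRealMaxSubfieldPowersHodgeClasses`; sixfold packaging `Ring2.Atlas.isMurtyTypeWith_sixfold_totallyRealSextic`).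
On each such `B` and on EVERYTHING ISOGENOUS to it (L7b transport `codimTwo/ThreeCensusAt_iff_of_isIsogenous`) both
census conclusions hold; for the field rows the members are moreover IN THE NODES' DOMAIN `dim = 6 ∧ ¬ 𝒞` (`𝒞` = CM ∪
K3-partner cell): `End⁰` a field ⟹ simple (`AbelianVariety.isSimple_of_isField_endAlgebra`), `dim_ℚ End⁰ < 12 = 2·dim` ⟹
not of CM type (§1), and simple ∧ ¬CM ⟹ off `𝒞` (L7 `not_residueClass_of_isSimple_of_not_isOfCMType`).

All declarations live in the sub-namespace `TableX.SimpleRows` (lead g2 DEDUP RULE 2026-08-28T20:17:40Z: L9 / L10 are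
import-independent, no shared generic declaration; both build directly on L8's entry points).
* §1 entry points: `SimpleRows.census_of_isIsogenous_of_isDivisorGenerated` (`IsDivisorGenerated B`, `A ∼ B` ⟹ X2-at-`A` ∧
  X1-at-`A`, a bundled convenience over L8); `SimpleRows.not_isOfCMType_of_finrank_endAlgebra_lt_two_mul_dim`,
  `SimpleRows.not_isOfCMType_of_noncomm_of_finrank_endAlgebra_le` (elementary CM-type exclusions);
  `SimpleRows.offResidueSix_of_isIsogenous_of_isSimple_of_not_isOfCMType`.
* §2 type I: `isDivisorGenerated_sixfold_of_isTotallyReal_endField` (`[End⁰:ℚ] ∈ {2,3,6}`), the master verdict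
  `census_sixfold_typeI_of_isIsogenous` («`dim 6 ∧ ¬ 𝒞` ∧ X2 ∧ X1» on the whole isogeny class), and the rows by name
  `census_row2_realQuadratic`, `census_row3_totallyRealCubic`, `census_row4_totallyRealSextic`.
* §3 Murty `m = 1`: `census_of_isIsogenous_of_isMurtyTypeWith_one` (any dimension), `census_sixfold_totallyRealSexticMaxSubfield_of_isIsogenous`
  (row `g6.II(3)` ∪ `g6.I(6)` as typed by `Ring2AtlasTypeIIRows`), `census_row6_of_isSimple_of_noncomm` (the same WITH
  domain membership for the simple members with non-commutative `End⁰` of `ℚ`-dimension `≤ 12` — the type-II(3) reading;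
  «type II(3) ⟹ these three elementary hypotheses» is Albert-classification MEMBERSHIP prose, not a tree theorem).

WHAT IS NOT COVERED (honest scope): row 1 `g6.I(1)` (`End⁰ = ℚ`: the tree has the row only modulo the NAMED print fact
`Tankeev1996_…` of `Ring2AtlasEndTrivialSixfoldRows`, and that fact yields algebraicity, not `B = D`); row 5 `g6.II(1)`
(`m = 3`: modulo the named fact `Murty1988_…` of `Ring2AtlasTypeIIRows`); rows 8 / 10 / 12 (type IV, non-Weil: no tree
`B = D` theorem; Ribet's coprime-signature theorem is a named fact only); the Weil-carrying rows 7 / 9 / 11 / 13 (`B³ ≠ D³`: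
they are what `NonsplitSixfolds` / Markman₆ are for); rows 14 / 15 (CM: outside the nodes' domain by definition). No
conditional census claim is made for any of them. FLOOR REMARK: on the rows treated here the CONCLUSION of L6
(`HodgeConjectureFor`) is already an unconditional theorem of the tree BY NAME — `hodgeConjectureFor_powSucc_sixfold_realQuadratic`,
`hodgeConjectureFor_powSucc_of_isTotallyReal_two_mul_finrank_eq_dim`, `hodgeConjectureFor_powSucc_of_isTotallyReal_finrank_eq_dim`,
`Ring2.Atlas.hodgeConjectureFor_sixfold_totallyRealSexticMaxSubfield`, transported by `hodgeConjectureFor_of_isIsogenous_of_isDivisorGenerated`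
— nothing is restated. No inhabitant is exhibited: the tree holds no existence record for a sixfold with real or
quaternionic multiplication, and none is invented here.

Nothing here is a corollary of `HC_CM`; no hypothesis of the cover is discharged GLOBALLY (X2 / X1 quantify over ALL
off-residue sixfolds and stay `@[conjecture]`); typed ≠ proved.
-/

set_option linter.dupNamespace false

noncomputable section

open CategoryTheory
open Literature.AlgebraicGeometry Literature.AlgebraicGeometry.Motives
open Literature.AlgebraicGeometry.Motives.AbelianVariety (IsIsogenous IsSimple isSimple_of_isField_endAlgebra)
open Literature.AlgebraicGeometry.ComplexMultiplication (EndField)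
open Literature.AlgebraicGeometry.HodgeTheory
open Literature.AlgebraicGeometry.Milne1999
open Literature.AlgebraicTopology.SingularHomology
open Literature.Barriers.HodgeConjecture
open Summit.HodgeConjecture.HodgeConjecture.Ring2.ClassTargets
open Summit.HodgeConjecture.HodgeConjecture.Ring2.Motiv (ProdCMCell)
open Summit.HodgeConjecture.HodgeConjecture.Ring2.Atlas (IsQuarticFieldTypeIVFourfold
  isMurtyTypeWith_sixfold_totallyRealSextic)

namespace Summit.HodgeConjecture.HodgeConjecture.TableX.SimpleRows

/-! ## §1 Entry points: `B = D` on a model ⟹ both census conclusions on the isogeny class; elementary CM exclusions -/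

/-- **`B•(B) = D•(B) ⊗ ℂ` on a model `B` gives BOTH census conclusions at every `A` isogenous to `B`** (the divisor
summand alone, L8 `codimTwo/ThreeCensusAt_of_isIsogenous_of_divisorial`, at `p = 2` and `p = 3` of `IsDivisorGenerated B`).
[cite: vanGeemen1994HodgeAV, §2.4–2.5 and Lemma 3.7] [cite: MoonenZarhin1999LowDim, §5 (5.1)] -/
theorem census_of_isIsogenous_of_isDivisorGenerated {A B : AbelianVariety ℂ} (hAB : IsIsogenous A B)
    (hD : IsDivisorGenerated B) :
    (∀ c : complexBetti A.X (2 * 2), IsRationalClass c → IsOfHodgeType A.dim A.X (2 * 2) 2 2 c →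
      c ∈ divisorClassesSpan A.X A.dim 2 ⊔ Submodule.span ℂ {w' : complexBetti A.X (2 * 2) |
        ∃ (C : AbelianVariety ℂ) (g : A.X ⟶ C.X) (w : complexBetti C.X (2 * 2)), C.dim < A.dim ∧
          IsRationalClass w ∧ IsOfHodgeType C.dim C.X (2 * 2) 2 2 w ∧ w' = complexBetti.map g (2 * 2) w}) ∧
    (∀ c : complexBetti A.X (2 * 3), IsRationalClass c → IsOfHodgeType A.dim A.X (2 * 3) 3 3 c →
      c ∈ divisorClassesSpan A.X A.dim 3 ⊔ Submodule.span ℂ {w' : complexBetti A.X (2 * 3) |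
          ∃ (a : complexBetti A.X (2 * 2)) (b : complexBetti A.X (2 * 1)),
            IsRationalClass a ∧ IsOfHodgeType A.dim A.X (2 * 2) 2 2 a ∧ IsRationalClass b ∧
            IsOfHodgeType A.dim A.X (2 * 1) 1 1 b ∧ w' = cupProduct (two_mul_add_two_mul 2 1) a b} ⊔
        Submodule.span ℂ {w' : complexBetti A.X (2 * 3) |
          ∃ (C : AbelianVariety ℂ) (g : A.X ⟶ C.X) (w : complexBetti C.X (2 * 3)), C.dim < A.dim ∧
            IsRationalClass w ∧ IsOfHodgeType C.dim C.X (2 * 3) 3 3 w ∧ w' = complexBetti.map g (2 * 3) w} ⊔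
        Submodule.span ℂ {w' : complexBetti A.X (2 * 3) |
          ∃ (B' : AbelianVariety ℂ) (g : A.X ⟶ B'.X) (d : ℕ) (ψ : B' ⟶ B') (w : complexBetti B'.X (2 * 3)),
            B'.dim = 6 ∧ 0 < d ∧ ψ ≫ ψ = -(d • 𝟙 B') ∧ IsRationalClass w ∧
            IsOfHodgeType B'.dim B'.X (2 * 3) 3 3 w ∧ w ∈ weilClassesOf B' ψ 3 d ∧
            w' = complexBetti.map g (2 * 3) w}) :=
  ⟨codimTwoCensusAt_of_isIsogenous_of_divisorial hAB fun c hcQ hcH ↦ hD 2 c hcQ hcH,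
    codimThreeCensusAt_of_isIsogenous_of_divisorial hAB fun c hcQ hcH ↦ hD 3 c hcQ hcH⟩

/-- **`dim_ℚ End⁰(A) < 2 dim A` excludes CM type**: a CM type needs a commutative subalgebra of `End⁰(A)` of
`ℚ`-dimension `2 dim A` (Milne 1999 §2 p. 54), and a subalgebra is no larger than `End⁰(A)` (finite-dimensional,
Mumford §19 Cor. 2). Elementary; the `End⁰ = ℚ` case is CorCM's `not_isOfCMType_of_finrank_endAlgebra_eq_one`.
[cite: Milne1999, §2 p. 54] [cite: MumfordAV1970, §19 Thm. 3 Cor. 2 (p. 182)] -/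
theorem not_isOfCMType_of_finrank_endAlgebra_lt_two_mul_dim {A : AbelianVariety ℂ}
    (h : Module.finrank ℚ A.endAlgebra < 2 * A.dim) : ¬ IsOfCMType A := by
  rintro ⟨S, -, -, hS⟩
  have hle : Module.finrank ℚ ↥S ≤ Module.finrank ℚ A.endAlgebra :=
    Submodule.finrank_le (Subalgebra.toSubmodule S)
  omega

/-- **A non-commutative `End⁰(A)` of `ℚ`-dimension `≤ 2 dim A` excludes CM type**: a commutative subalgebra of
dimension `2 dim A ≥ dim End⁰(A)` would be all of `End⁰(A)`, which is not commutative (the type-II / type-III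
reading: quaternion algebras of dimension `2 dim A`). Elementary. [cite: Milne1999, §2 p. 54]
[cite: MumfordAV1970, §19 Thm. 3 Cor. 2 (p. 182) and §21 (Albert types II, III)] -/
theorem not_isOfCMType_of_noncomm_of_finrank_endAlgebra_le {A : AbelianVariety ℂ}
    (h : Module.finrank ℚ A.endAlgebra ≤ 2 * A.dim) (hnc : ∃ x y : A.endAlgebra, x * y ≠ y * x) :
    ¬ IsOfCMType A := by
  rintro ⟨S, -, hcomm, hS⟩
  obtain ⟨x, y, hxy⟩ := hnc
  have hle : Module.finrank ℚ ↥S ≤ Module.finrank ℚ A.endAlgebra :=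
    Submodule.finrank_le (Subalgebra.toSubmodule S)
  have hfin : Module.finrank ℚ ↥(Subalgebra.toSubmodule S) = Module.finrank ℚ A.endAlgebra := by
    rw [Subalgebra.finrank_toSubmodule]; omega
  -- explicit instance arguments: the two `AddCommMonoid` paths on `End⁰(A)` (`Algebra.TensorProduct.instRing`)
  -- are not identified by instance search (see `Motives/AbelianVarietyEndAlgebraInstances`)
  have htop : Subalgebra.toSubmodule S = ⊤ :=
    @Submodule.eq_top_of_finrank_eq ℚ A.endAlgebra _ Ring.toAddCommGroup Algebra.toModule
      (AbelianVariety.finiteDimensional_endAlgebra_holds A) _ hfin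
  have hS' : S = ⊤ := Algebra.toSubmodule_eq_top.mp htop
  have hx : x ∈ S := by rw [hS']; exact Algebra.mem_top
  have hy : y ∈ S := by rw [hS']; exact Algebra.mem_top
  exact hxy (hcomm x hx y hy)

/-- **Everything isogenous to a SIMPLE sixfold NOT of CM type is in the nodes' domain `dim = 6 ∧ ¬ 𝒞`** (L7:
`offResidueSix_iff_of_isIsogenous`, `not_residueClass_of_isSimple_of_not_isOfCMType`). [cite: Milne1999, §2 p. 54]
[cite: MumfordAV1970, §19 Thm. 3 (p. 176)] -/
theorem offResidueSix_of_isIsogenous_of_isSimple_of_not_isOfCMType {A B : AbelianVariety ℂ}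
    (hAB : IsIsogenous A B) (hB : B.dim = 6) (hs : B.IsSimple) (hcm : ¬ IsOfCMType B) :
    A.dim = 6 ∧ ¬ (IsOfCMType A ∨ ProdCMCell IsQuarticFieldTypeIVFourfold (fun Z ↦ Z.dim = 2) A) :=
  (offResidueSix_iff_of_isIsogenous hAB).mpr ⟨hB, not_residueClass_of_isSimple_of_not_isOfCMType hs hcm⟩

/-! ## §2 Type I: `End⁰(B)` a totally real field of degree `2`, `3` or `6` (TABLE X rows 2, 3, 4) -/

/-- **`B = D` on a sixfold whose endomorphism algebra is a totally real field of degree `2`, `3` or `6`** — relative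
dimension `3` (Ribet 1983 Thm. 1, tree theorem `isDivisorGenerated_of_isTotallyReal_of_three_mul_finrank_eq`), `2`
(Moonen–Zarhin Type I(2), `…_of_two_mul_finrank_eq`) resp. `1` (Ribet Thm. 0, `isDivisorGenerated_of_isTotallyReal`);
all three UNCONDITIONAL in the tree. [cite: Ribet1983, Thms. 0 and 1] [cite: MoonenZarhin1995Duke, Type I(2)]
[cite: Gordon1997, Thms. 6.1–6.3 (arXiv:alg-geom/9709030 p. 18)] -/
theorem isDivisorGenerated_sixfold_of_isTotallyReal_endField {B : AbelianVariety ℂ} (hB : B.dim = 6)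
    (hF : IsField B.endAlgebra) (hT : NumberField.IsTotallyReal (EndField B hF))
    (he : Module.finrank ℚ B.endAlgebra = 2 ∨ Module.finrank ℚ B.endAlgebra = 3 ∨
      Module.finrank ℚ B.endAlgebra = 6) : IsDivisorGenerated B := by
  haveI := hT
  rcases he with he | he | he
  · exact AbelianVariety.isDivisorGenerated_of_isTotallyReal_of_three_mul_finrank_eq B hF (by omega)
  · exact AbelianVariety.isDivisorGenerated_of_isTotallyReal_of_two_mul_finrank_eq B hF (by omega)
  · exact AbelianVariety.isDivisorGenerated_of_isTotallyReal B hF (by omega)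

/-- **TYPE I SIXFOLDS WITH REAL MULTIPLICATION (TABLE X rows 2 / 3 / 4), KERNEL VERDICT on the whole isogeny class.**
For a complex abelian sixfold `B` whose endomorphism algebra is a totally real field of degree `2`, `3` or `6`, and every
`A` isogenous to `B`: `dim A = 6` and `A` is OFF the residue class `𝒞` (`B` is simple with `dim_ℚ End⁰(B) < 12`, so not of
CM type; L7 transport) — `A` is in the domain of the census nodes —, AND both census conclusions X2-at-`A`, X1-at-`A` hold
(`B = D` on `B`, divisor summand alone, L7b transport). UNCONDITIONAL; no named fact. [cite: Ribet1983, Thms. 0 and 1]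
[cite: MoonenZarhin1995Duke, Type I(2)] [cite: MoonenZarhin1999LowDim, §5 (5.1)] [cite: vanGeemen1994HodgeAV, Lemma 3.7]
[cite: Milne1999, §2 p. 54] -/
theorem census_sixfold_typeI_of_isIsogenous {A B : AbelianVariety ℂ} (hB : B.dim = 6)
    (hF : IsField B.endAlgebra) (hT : NumberField.IsTotallyReal (EndField B hF))
    (he : Module.finrank ℚ B.endAlgebra = 2 ∨ Module.finrank ℚ B.endAlgebra = 3 ∨
      Module.finrank ℚ B.endAlgebra = 6) (hAB : IsIsogenous A B) :
    (A.dim = 6 ∧ ¬ (IsOfCMType A ∨ ProdCMCell IsQuarticFieldTypeIVFourfold (fun Z ↦ Z.dim = 2) A)) ∧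
    (∀ c : complexBetti A.X (2 * 2), IsRationalClass c → IsOfHodgeType A.dim A.X (2 * 2) 2 2 c →
      c ∈ divisorClassesSpan A.X A.dim 2 ⊔ Submodule.span ℂ {w' : complexBetti A.X (2 * 2) |
        ∃ (C : AbelianVariety ℂ) (g : A.X ⟶ C.X) (w : complexBetti C.X (2 * 2)), C.dim < A.dim ∧
          IsRationalClass w ∧ IsOfHodgeType C.dim C.X (2 * 2) 2 2 w ∧ w' = complexBetti.map g (2 * 2) w}) ∧
    (∀ c : complexBetti A.X (2 * 3), IsRationalClass c → IsOfHodgeType A.dim A.X (2 * 3) 3 3 c →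
      c ∈ divisorClassesSpan A.X A.dim 3 ⊔ Submodule.span ℂ {w' : complexBetti A.X (2 * 3) |
          ∃ (a : complexBetti A.X (2 * 2)) (b : complexBetti A.X (2 * 1)),
            IsRationalClass a ∧ IsOfHodgeType A.dim A.X (2 * 2) 2 2 a ∧ IsRationalClass b ∧
            IsOfHodgeType A.dim A.X (2 * 1) 1 1 b ∧ w' = cupProduct (two_mul_add_two_mul 2 1) a b} ⊔
        Submodule.span ℂ {w' : complexBetti A.X (2 * 3) |
          ∃ (C : AbelianVariety ℂ) (g : A.X ⟶ C.X) (w : complexBetti C.X (2 * 3)), C.dim < A.dim ∧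
            IsRationalClass w ∧ IsOfHodgeType C.dim C.X (2 * 3) 3 3 w ∧ w' = complexBetti.map g (2 * 3) w} ⊔
        Submodule.span ℂ {w' : complexBetti A.X (2 * 3) |
          ∃ (B' : AbelianVariety ℂ) (g : A.X ⟶ B'.X) (d : ℕ) (ψ : B' ⟶ B') (w : complexBetti B'.X (2 * 3)),
            B'.dim = 6 ∧ 0 < d ∧ ψ ≫ ψ = -(d • 𝟙 B') ∧ IsRationalClass w ∧
            IsOfHodgeType B'.dim B'.X (2 * 3) 3 3 w ∧ w ∈ weilClassesOf B' ψ 3 d ∧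
            w' = complexBetti.map g (2 * 3) w}) := by
  refine ⟨offResidueSix_of_isIsogenous_of_isSimple_of_not_isOfCMType hAB hB (isSimple_of_isField_endAlgebra hF)
      (not_isOfCMType_of_finrank_endAlgebra_lt_two_mul_dim (by omega)), ?_⟩
  exact census_of_isIsogenous_of_isDivisorGenerated hAB
    (isDivisorGenerated_sixfold_of_isTotallyReal_endField hB hF hT he)

/-- **TABLE X ROW 2 `g6.I(2)` — `End⁰(B)` a REAL QUADRATIC field (Ribet 1983, relative dimension three): every `A ∼ B`
is in the nodes' domain and satisfies X2-at-`A` ∧ X1-at-`A`.** UNCONDITIONAL. [cite: Ribet1983, Thm. 1 with Thm. 0]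
[cite: Gordon1997, Thm. 6.3 (arXiv:alg-geom/9709030 p. 18)] [cite: MoonenZarhin1999LowDim, §5 (5.1)] -/
theorem census_row2_realQuadratic {A B : AbelianVariety ℂ} (hB : B.dim = 6) (hF : IsField B.endAlgebra)
    (hT : NumberField.IsTotallyReal (EndField B hF)) (he : Module.finrank ℚ B.endAlgebra = 2)
    (hAB : IsIsogenous A B) :
    (A.dim = 6 ∧ ¬ (IsOfCMType A ∨ ProdCMCell IsQuarticFieldTypeIVFourfold (fun Z ↦ Z.dim = 2) A)) ∧
    (∀ c : complexBetti A.X (2 * 2), IsRationalClass c → IsOfHodgeType A.dim A.X (2 * 2) 2 2 c →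
      c ∈ divisorClassesSpan A.X A.dim 2 ⊔ Submodule.span ℂ {w' : complexBetti A.X (2 * 2) |
        ∃ (C : AbelianVariety ℂ) (g : A.X ⟶ C.X) (w : complexBetti C.X (2 * 2)), C.dim < A.dim ∧
          IsRationalClass w ∧ IsOfHodgeType C.dim C.X (2 * 2) 2 2 w ∧ w' = complexBetti.map g (2 * 2) w}) ∧
    (∀ c : complexBetti A.X (2 * 3), IsRationalClass c → IsOfHodgeType A.dim A.X (2 * 3) 3 3 c →
      c ∈ divisorClassesSpan A.X A.dim 3 ⊔ Submodule.span ℂ {w' : complexBetti A.X (2 * 3) |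
          ∃ (a : complexBetti A.X (2 * 2)) (b : complexBetti A.X (2 * 1)),
            IsRationalClass a ∧ IsOfHodgeType A.dim A.X (2 * 2) 2 2 a ∧ IsRationalClass b ∧
            IsOfHodgeType A.dim A.X (2 * 1) 1 1 b ∧ w' = cupProduct (two_mul_add_two_mul 2 1) a b} ⊔
        Submodule.span ℂ {w' : complexBetti A.X (2 * 3) |
          ∃ (C : AbelianVariety ℂ) (g : A.X ⟶ C.X) (w : complexBetti C.X (2 * 3)), C.dim < A.dim ∧
            IsRationalClass w ∧ IsOfHodgeType C.dim C.X (2 * 3) 3 3 w ∧ w' = complexBetti.map g (2 * 3) w} ⊔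
        Submodule.span ℂ {w' : complexBetti A.X (2 * 3) |
          ∃ (B' : AbelianVariety ℂ) (g : A.X ⟶ B'.X) (d : ℕ) (ψ : B' ⟶ B') (w : complexBetti B'.X (2 * 3)),
            B'.dim = 6 ∧ 0 < d ∧ ψ ≫ ψ = -(d • 𝟙 B') ∧ IsRationalClass w ∧
            IsOfHodgeType B'.dim B'.X (2 * 3) 3 3 w ∧ w ∈ weilClassesOf B' ψ 3 d ∧
            w' = complexBetti.map g (2 * 3) w}) :=
  census_sixfold_typeI_of_isIsogenous hB hF hT (Or.inl he) hAB

/-- **TABLE X ROW 3 `g6.I(3)` — `End⁰(B)` a TOTALLY REAL CUBIC field (relative dimension two): every `A ∼ B` is in the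
nodes' domain and satisfies X2-at-`A` ∧ X1-at-`A`.** UNCONDITIONAL. [cite: MoonenZarhin1995Duke, Type I(2)]
[cite: Ribet1983, Thm. 0] [cite: Gordon1997, Thm. 6.2 and §7.7] [cite: MoonenZarhin1999LowDim, §5 (5.1)] -/
theorem census_row3_totallyRealCubic {A B : AbelianVariety ℂ} (hB : B.dim = 6) (hF : IsField B.endAlgebra)
    (hT : NumberField.IsTotallyReal (EndField B hF)) (he : Module.finrank ℚ B.endAlgebra = 3)
    (hAB : IsIsogenous A B) :
    (A.dim = 6 ∧ ¬ (IsOfCMType A ∨ ProdCMCell IsQuarticFieldTypeIVFourfold (fun Z ↦ Z.dim = 2) A)) ∧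
    (∀ c : complexBetti A.X (2 * 2), IsRationalClass c → IsOfHodgeType A.dim A.X (2 * 2) 2 2 c →
      c ∈ divisorClassesSpan A.X A.dim 2 ⊔ Submodule.span ℂ {w' : complexBetti A.X (2 * 2) |
        ∃ (C : AbelianVariety ℂ) (g : A.X ⟶ C.X) (w : complexBetti C.X (2 * 2)), C.dim < A.dim ∧
          IsRationalClass w ∧ IsOfHodgeType C.dim C.X (2 * 2) 2 2 w ∧ w' = complexBetti.map g (2 * 2) w}) ∧
    (∀ c : complexBetti A.X (2 * 3), IsRationalClass c → IsOfHodgeType A.dim A.X (2 * 3) 3 3 c →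
      c ∈ divisorClassesSpan A.X A.dim 3 ⊔ Submodule.span ℂ {w' : complexBetti A.X (2 * 3) |
          ∃ (a : complexBetti A.X (2 * 2)) (b : complexBetti A.X (2 * 1)),
            IsRationalClass a ∧ IsOfHodgeType A.dim A.X (2 * 2) 2 2 a ∧ IsRationalClass b ∧
            IsOfHodgeType A.dim A.X (2 * 1) 1 1 b ∧ w' = cupProduct (two_mul_add_two_mul 2 1) a b} ⊔
        Submodule.span ℂ {w' : complexBetti A.X (2 * 3) |
          ∃ (C : AbelianVariety ℂ) (g : A.X ⟶ C.X) (w : complexBetti C.X (2 * 3)), C.dim < A.dim ∧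
            IsRationalClass w ∧ IsOfHodgeType C.dim C.X (2 * 3) 3 3 w ∧ w' = complexBetti.map g (2 * 3) w} ⊔
        Submodule.span ℂ {w' : complexBetti A.X (2 * 3) |
          ∃ (B' : AbelianVariety ℂ) (g : A.X ⟶ B'.X) (d : ℕ) (ψ : B' ⟶ B') (w : complexBetti B'.X (2 * 3)),
            B'.dim = 6 ∧ 0 < d ∧ ψ ≫ ψ = -(d • 𝟙 B') ∧ IsRationalClass w ∧
            IsOfHodgeType B'.dim B'.X (2 * 3) 3 3 w ∧ w ∈ weilClassesOf B' ψ 3 d ∧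
            w' = complexBetti.map g (2 * 3) w}) :=
  census_sixfold_typeI_of_isIsogenous hB hF hT (Or.inr (Or.inl he)) hAB

/-- **TABLE X ROW 4 `g6.I(6)` — `End⁰(B)` a TOTALLY REAL SEXTIC field (Ribet 1983 Thm. 0, relative dimension one,
`Hg = R_{F/ℚ} SL₂`): every `A ∼ B` is in the nodes' domain and satisfies X2-at-`A` ∧ X1-at-`A`.** UNCONDITIONAL.
[cite: Ribet1983, Thm. 0 (pp. 523–525)] [cite: Hazama1983, Thm. (1.1)] [cite: MoonenZarhin1999LowDim, §5 (5.1)] -/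
theorem census_row4_totallyRealSextic {A B : AbelianVariety ℂ} (hB : B.dim = 6) (hF : IsField B.endAlgebra)
    (hT : NumberField.IsTotallyReal (EndField B hF)) (he : Module.finrank ℚ B.endAlgebra = 6)
    (hAB : IsIsogenous A B) :
    (A.dim = 6 ∧ ¬ (IsOfCMType A ∨ ProdCMCell IsQuarticFieldTypeIVFourfold (fun Z ↦ Z.dim = 2) A)) ∧
    (∀ c : complexBetti A.X (2 * 2), IsRationalClass c → IsOfHodgeType A.dim A.X (2 * 2) 2 2 c →
      c ∈ divisorClassesSpan A.X A.dim 2 ⊔ Submodule.span ℂ {w' : complexBetti A.X (2 * 2) |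
        ∃ (C : AbelianVariety ℂ) (g : A.X ⟶ C.X) (w : complexBetti C.X (2 * 2)), C.dim < A.dim ∧
          IsRationalClass w ∧ IsOfHodgeType C.dim C.X (2 * 2) 2 2 w ∧ w' = complexBetti.map g (2 * 2) w}) ∧
    (∀ c : complexBetti A.X (2 * 3), IsRationalClass c → IsOfHodgeType A.dim A.X (2 * 3) 3 3 c →
      c ∈ divisorClassesSpan A.X A.dim 3 ⊔ Submodule.span ℂ {w' : complexBetti A.X (2 * 3) |
          ∃ (a : complexBetti A.X (2 * 2)) (b : complexBetti A.X (2 * 1)),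
            IsRationalClass a ∧ IsOfHodgeType A.dim A.X (2 * 2) 2 2 a ∧ IsRationalClass b ∧
            IsOfHodgeType A.dim A.X (2 * 1) 1 1 b ∧ w' = cupProduct (two_mul_add_two_mul 2 1) a b} ⊔
        Submodule.span ℂ {w' : complexBetti A.X (2 * 3) |
          ∃ (C : AbelianVariety ℂ) (g : A.X ⟶ C.X) (w : complexBetti C.X (2 * 3)), C.dim < A.dim ∧
            IsRationalClass w ∧ IsOfHodgeType C.dim C.X (2 * 3) 3 3 w ∧ w' = complexBetti.map g (2 * 3) w} ⊔
        Submodule.span ℂ {w' : complexBetti A.X (2 * 3) |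
          ∃ (B' : AbelianVariety ℂ) (g : A.X ⟶ B'.X) (d : ℕ) (ψ : B' ⟶ B') (w : complexBetti B'.X (2 * 3)),
            B'.dim = 6 ∧ 0 < d ∧ ψ ≫ ψ = -(d • 𝟙 B') ∧ IsRationalClass w ∧
            IsOfHodgeType B'.dim B'.X (2 * 3) 3 3 w ∧ w ∈ weilClassesOf B' ψ 3 d ∧
            w' = complexBetti.map g (2 * 3) w}) :=
  census_sixfold_typeI_of_isIsogenous hB hF hT (Or.inr (Or.inr he)) hAB

/-! ## §3 Murty packets `(K, φ, 1)`: a self-commutant totally real subfield of degree `dim` (TABLE X row 6 `g6.II(3)`,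
and row 4 again) -/

section Murty

variable {K : Type} [Field K] [NumberField K]

/-- **Both census conclusions on everything isogenous to an abelian variety with a Murty packet `(K, φ, 1)`** — `K`
totally real, `φ : K →+* End⁰(B)` its own commutant, `[K:ℚ] = dim B`: V. K. Murty 1988 Thm. 2 (`m = 1`) is a tree
theorem (`AbelianVariety.isDivisorGenerated_of_isMurtyTypeWith_one`), so `B = D` on `B`; transported by L7b. Any
dimension; UNCONDITIONAL. [cite: Murty1988, Thm. 2 (p. 67) and p. 66] [cite: Hazama1983, Thm. (1.1)]
[cite: MoonenZarhin1999LowDim, (1.8) and §5 (5.1)] [cite: vanGeemen1994HodgeAV, Lemma 3.7] -/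
theorem census_of_isIsogenous_of_isMurtyTypeWith_one {A B : AbelianVariety ℂ} {φ : K →+* B.endAlgebra}
    (hM : IsMurtyTypeWith B K φ 1) (hAB : IsIsogenous A B) :
    (∀ c : complexBetti A.X (2 * 2), IsRationalClass c → IsOfHodgeType A.dim A.X (2 * 2) 2 2 c →
      c ∈ divisorClassesSpan A.X A.dim 2 ⊔ Submodule.span ℂ {w' : complexBetti A.X (2 * 2) |
        ∃ (C : AbelianVariety ℂ) (g : A.X ⟶ C.X) (w : complexBetti C.X (2 * 2)), C.dim < A.dim ∧
          IsRationalClass w ∧ IsOfHodgeType C.dim C.X (2 * 2) 2 2 w ∧ w' = complexBetti.map g (2 * 2) w}) ∧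
    (∀ c : complexBetti A.X (2 * 3), IsRationalClass c → IsOfHodgeType A.dim A.X (2 * 3) 3 3 c →
      c ∈ divisorClassesSpan A.X A.dim 3 ⊔ Submodule.span ℂ {w' : complexBetti A.X (2 * 3) |
          ∃ (a : complexBetti A.X (2 * 2)) (b : complexBetti A.X (2 * 1)),
            IsRationalClass a ∧ IsOfHodgeType A.dim A.X (2 * 2) 2 2 a ∧ IsRationalClass b ∧
            IsOfHodgeType A.dim A.X (2 * 1) 1 1 b ∧ w' = cupProduct (two_mul_add_two_mul 2 1) a b} ⊔
        Submodule.span ℂ {w' : complexBetti A.X (2 * 3) |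
          ∃ (C : AbelianVariety ℂ) (g : A.X ⟶ C.X) (w : complexBetti C.X (2 * 3)), C.dim < A.dim ∧
            IsRationalClass w ∧ IsOfHodgeType C.dim C.X (2 * 3) 3 3 w ∧ w' = complexBetti.map g (2 * 3) w} ⊔
        Submodule.span ℂ {w' : complexBetti A.X (2 * 3) |
          ∃ (B' : AbelianVariety ℂ) (g : A.X ⟶ B'.X) (d : ℕ) (ψ : B' ⟶ B') (w : complexBetti B'.X (2 * 3)),
            B'.dim = 6 ∧ 0 < d ∧ ψ ≫ ψ = -(d • 𝟙 B') ∧ IsRationalClass w ∧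
            IsOfHodgeType B'.dim B'.X (2 * 3) 3 3 w ∧ w ∈ weilClassesOf B' ψ 3 d ∧
            w' = complexBetti.map g (2 * 3) w}) :=
  census_of_isIsogenous_of_isDivisorGenerated hAB (AbelianVariety.isDivisorGenerated_of_isMurtyTypeWith_one B hM)

/-- **TABLE X ROW 6 `g6.II(3)` (as typed by `Ring2AtlasTypeIIRows`: a complex abelian SIXFOLD whose endomorphism algebra
contains a self-commutant TOTALLY REAL SEXTIC field — in particular every simple sixfold of type II(3), and those of type
I(6)): both census conclusions X2-at-`A`, X1-at-`A` at every `A ∼ B`.** UNCONDITIONAL (Murty 1988 Thm. 2, `m = 1`, proved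
in the tree). Domain membership is NOT part of this statement (see `census_row6_of_isSimple_of_noncomm`).
[cite: Murty1988, Thm. 2 (p. 67) and p. 66] [cite: MoonenZarhin1999LowDim, (1.8) and §5 (5.1)] [cite: Hazama1983, Thm. (1.1)] -/
theorem census_sixfold_totallyRealSexticMaxSubfield_of_isIsogenous {A B : AbelianVariety ℂ} (hB : B.dim = 6)
    (hK : NumberField.IsTotallyReal K) (h6 : Module.finrank ℚ K = 6) (φ : K →+* B.endAlgebra)
    (hφ : ∀ x : B.endAlgebra, (∀ y : K, Commute x (φ y)) → x ∈ Set.range φ) (hAB : IsIsogenous A B) :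
    (∀ c : complexBetti A.X (2 * 2), IsRationalClass c → IsOfHodgeType A.dim A.X (2 * 2) 2 2 c →
      c ∈ divisorClassesSpan A.X A.dim 2 ⊔ Submodule.span ℂ {w' : complexBetti A.X (2 * 2) |
        ∃ (C : AbelianVariety ℂ) (g : A.X ⟶ C.X) (w : complexBetti C.X (2 * 2)), C.dim < A.dim ∧
          IsRationalClass w ∧ IsOfHodgeType C.dim C.X (2 * 2) 2 2 w ∧ w' = complexBetti.map g (2 * 2) w}) ∧
    (∀ c : complexBetti A.X (2 * 3), IsRationalClass c → IsOfHodgeType A.dim A.X (2 * 3) 3 3 c →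
      c ∈ divisorClassesSpan A.X A.dim 3 ⊔ Submodule.span ℂ {w' : complexBetti A.X (2 * 3) |
          ∃ (a : complexBetti A.X (2 * 2)) (b : complexBetti A.X (2 * 1)),
            IsRationalClass a ∧ IsOfHodgeType A.dim A.X (2 * 2) 2 2 a ∧ IsRationalClass b ∧
            IsOfHodgeType A.dim A.X (2 * 1) 1 1 b ∧ w' = cupProduct (two_mul_add_two_mul 2 1) a b} ⊔
        Submodule.span ℂ {w' : complexBetti A.X (2 * 3) |
          ∃ (C : AbelianVariety ℂ) (g : A.X ⟶ C.X) (w : complexBetti C.X (2 * 3)), C.dim < A.dim ∧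
            IsRationalClass w ∧ IsOfHodgeType C.dim C.X (2 * 3) 3 3 w ∧ w' = complexBetti.map g (2 * 3) w} ⊔
        Submodule.span ℂ {w' : complexBetti A.X (2 * 3) |
          ∃ (B' : AbelianVariety ℂ) (g : A.X ⟶ B'.X) (d : ℕ) (ψ : B' ⟶ B') (w : complexBetti B'.X (2 * 3)),
            B'.dim = 6 ∧ 0 < d ∧ ψ ≫ ψ = -(d • 𝟙 B') ∧ IsRationalClass w ∧
            IsOfHodgeType B'.dim B'.X (2 * 3) 3 3 w ∧ w ∈ weilClassesOf B' ψ 3 d ∧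
            w' = complexBetti.map g (2 * 3) w}) :=
  census_of_isIsogenous_of_isMurtyTypeWith_one (isMurtyTypeWith_sixfold_totallyRealSextic hB hK h6 hφ) hAB

/-- **ROW 6, WITH DOMAIN MEMBERSHIP, for the SIMPLE members with NON-COMMUTATIVE `End⁰` of `ℚ`-dimension `≤ 12`** (the
type-II(3) reading: `End⁰(B)` an indefinite quaternion algebra over a totally real cubic field, `dim_ℚ = 12`; that every
simple type-II(3) sixfold meets these three elementary hypotheses and carries the sextic packet is Albert-classification
MEMBERSHIP prose, as in `Ring2AtlasTypeIIRows`, not a tree theorem): every `A ∼ B` is in the nodes' domain `dim 6 ∧ ¬ 𝒞`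
(simple; not CM by `not_isOfCMType_of_noncomm_of_finrank_endAlgebra_le`) AND satisfies X2-at-`A` ∧ X1-at-`A`. UNCONDITIONAL.
[cite: Murty1988, Thm. 2 (p. 67)] [cite: MumfordAV1970, §19 Thm. 3 Cor. 2 and §21 (type II)] [cite: Milne1999, §2 p. 54]
[cite: MoonenZarhin1999LowDim, (1.8) and §5 (5.1)] -/
theorem census_row6_of_isSimple_of_noncomm {A B : AbelianVariety ℂ} (hB : B.dim = 6) (hs : B.IsSimple)
    (h12 : Module.finrank ℚ B.endAlgebra ≤ 12) (hnc : ∃ x y : B.endAlgebra, x * y ≠ y * x)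
    (hK : NumberField.IsTotallyReal K) (h6 : Module.finrank ℚ K = 6) (φ : K →+* B.endAlgebra)
    (hφ : ∀ x : B.endAlgebra, (∀ y : K, Commute x (φ y)) → x ∈ Set.range φ) (hAB : IsIsogenous A B) :
    (A.dim = 6 ∧ ¬ (IsOfCMType A ∨ ProdCMCell IsQuarticFieldTypeIVFourfold (fun Z ↦ Z.dim = 2) A)) ∧
    (∀ c : complexBetti A.X (2 * 2), IsRationalClass c → IsOfHodgeType A.dim A.X (2 * 2) 2 2 c →
      c ∈ divisorClassesSpan A.X A.dim 2 ⊔ Submodule.span ℂ {w' : complexBetti A.X (2 * 2) |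
        ∃ (C : AbelianVariety ℂ) (g : A.X ⟶ C.X) (w : complexBetti C.X (2 * 2)), C.dim < A.dim ∧
          IsRationalClass w ∧ IsOfHodgeType C.dim C.X (2 * 2) 2 2 w ∧ w' = complexBetti.map g (2 * 2) w}) ∧
    (∀ c : complexBetti A.X (2 * 3), IsRationalClass c → IsOfHodgeType A.dim A.X (2 * 3) 3 3 c →
      c ∈ divisorClassesSpan A.X A.dim 3 ⊔ Submodule.span ℂ {w' : complexBetti A.X (2 * 3) |
          ∃ (a : complexBetti A.X (2 * 2)) (b : complexBetti A.X (2 * 1)),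
            IsRationalClass a ∧ IsOfHodgeType A.dim A.X (2 * 2) 2 2 a ∧ IsRationalClass b ∧
            IsOfHodgeType A.dim A.X (2 * 1) 1 1 b ∧ w' = cupProduct (two_mul_add_two_mul 2 1) a b} ⊔
        Submodule.span ℂ {w' : complexBetti A.X (2 * 3) |
          ∃ (C : AbelianVariety ℂ) (g : A.X ⟶ C.X) (w : complexBetti C.X (2 * 3)), C.dim < A.dim ∧
            IsRationalClass w ∧ IsOfHodgeType C.dim C.X (2 * 3) 3 3 w ∧ w' = complexBetti.map g (2 * 3) w} ⊔
        Submodule.span ℂ {w' : complexBetti A.X (2 * 3) |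
          ∃ (B' : AbelianVariety ℂ) (g : A.X ⟶ B'.X) (d : ℕ) (ψ : B' ⟶ B') (w : complexBetti B'.X (2 * 3)),
            B'.dim = 6 ∧ 0 < d ∧ ψ ≫ ψ = -(d • 𝟙 B') ∧ IsRationalClass w ∧
            IsOfHodgeType B'.dim B'.X (2 * 3) 3 3 w ∧ w ∈ weilClassesOf B' ψ 3 d ∧
            w' = complexBetti.map g (2 * 3) w}) :=
  ⟨offResidueSix_of_isIsogenous_of_isSimple_of_not_isOfCMType hAB hB hs
      (not_isOfCMType_of_noncomm_of_finrank_endAlgebra_le (by omega) hnc),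
    census_sixfold_totallyRealSexticMaxSubfield_of_isIsogenous hB hK h6 φ hφ hAB⟩

end Murty

end Summit.HodgeConjecture.HodgeConjecture.TableX.SimpleRows
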